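import Mathlib

/-!
# Odd automorphic functions on `Γ₀(1951)` have vanishing constant terms at both cusps

Stub P1 `stub_oddConstantTerms` of line `ParityPurePoint` (crux stmt-Langlands-15897,
`Summit.Langlands.Langlands.Theses.QuarterDeficit1951.QuarterFingerprintDeficit`), kernel-proved.

If `u : ℍ → ℂ` satisfies the crux's automorphy clause `u (γ • z) = χ(d_γ) u z` for `γ ∈ Γ₀(1951)` and is ODD
under the reflection `R : z ↦ -z̄` (`UpperHalfPlane.J • z`), then for every `y > 0`
`∫₀¹ u(x+iy) dx = 0` and `∫₀^{1951} u(S•(x+iy)) dx = 0` — the two constant-term clauses of the crux's `IsForm`.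

Proof: `x ↦ u(x+iy)` has period `1` (`T ∈ Γ₀(1951)`, `χ(1) = 1`) and is odd (`R(x+iy) = -x+iy`), so
`∫₀¹ g = ∫₋₁⁰ g = ∫₀¹ g(-x) dx = -∫₀¹ g`; likewise `x ↦ u(S•(x+iy))` has period `1951`
(`S T^{1951} = [[1,0],[-1951,1]] S` with `[[1,0],[-1951,1]] ∈ Γ₀(1951)`, `d = 1`) and is odd (`S•(R w) = R(S•w)`).
No integrability is needed: `intervalIntegral.integral_comp_neg` / `integral_comp_sub_right` are unconditional.
-/

set_option linter.dupNamespace false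

namespace Summit.Langlands.Langlands.Theorems.QuarterFingerprintDeficit

open scoped MatrixGroups ComplexConjugate
open UpperHalfPlane

/-- `R(x + iy) = -x + iy` as points of `ℍ` (`y > 0`). [folklore] -/
theorem J_smul_ofComplex (x y : ℝ) (hy : 0 < y) :
    J • ofComplex ((x : ℂ) + y * Complex.I) = ofComplex (((-x : ℝ) : ℂ) + y * Complex.I) := by
  have h1 : 0 < ((x : ℂ) + y * Complex.I).im := by simpa using hy
  have h2 : 0 < ((((-x : ℝ)) : ℂ) + y * Complex.I).im := by simpa using hy
  apply UpperHalfPlane.ext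
  rw [coe_J_smul, ofComplex_apply_of_im_pos h1, ofComplex_apply_of_im_pos h2, coe_mk, coe_mk]
  apply Complex.ext <;> simp

/-- Translation by `1`: `T • (x + iy) = (x + 1) + iy`. [folklore] -/
theorem T_smul_ofComplex (x y : ℝ) (hy : 0 < y) :
    ModularGroup.T • ofComplex ((x : ℂ) + y * Complex.I) = ofComplex (((x + 1 : ℝ) : ℂ) + y * Complex.I) := by
  have h1 : 0 < ((x : ℂ) + y * Complex.I).im := by simpa using hy
  have h2 : 0 < ((((x + 1 : ℝ)) : ℂ) + y * Complex.I).im := by simpa using hy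
  apply UpperHalfPlane.ext
  rw [modular_T_smul, coe_vadd, ofComplex_apply_of_im_pos h1, ofComplex_apply_of_im_pos h2, coe_mk, coe_mk]
  push_cast; ring

/-- Translation by `n`: `T^n • (x + iy) = (x + n) + iy`. [folklore] -/
theorem T_zpow_smul_ofComplex (n : ℤ) (x y : ℝ) (hy : 0 < y) :
    ModularGroup.T ^ n • ofComplex ((x : ℂ) + y * Complex.I) =
      ofComplex (((x + n : ℝ) : ℂ) + y * Complex.I) := by
  have h1 : 0 < ((x : ℂ) + y * Complex.I).im := by simpa using hy
  have h2 : 0 < ((((x + n : ℝ)) : ℂ) + y * Complex.I).im := by simpa using hy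
  apply UpperHalfPlane.ext
  rw [modular_T_zpow_smul, coe_vadd, ofComplex_apply_of_im_pos h1, ofComplex_apply_of_im_pos h2,
    coe_mk, coe_mk]
  push_cast; ring

/-- `S` commutes with the reflection: `S•(R w) = R(S•w)` (both are `1/w̄`). [folklore] -/
theorem S_smul_J_smul (w : ℍ) : ModularGroup.S • (J • w) = J • (ModularGroup.S • w) := by
  apply UpperHalfPlane.ext
  rw [coe_J_smul, modular_S_smul, modular_S_smul, coe_mk, coe_mk, coe_J_smul]
  simp [map_neg, map_inv₀]

/-- The element `[[1,0],[-1951,1]] ∈ SL₂(ℤ)`. [folklore] -/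
def γ₀ : SL(2, ℤ) := ⟨!![1, 0; -1951, 1], by norm_num [Matrix.det_fin_two_of]⟩

/-- `S T^{1951} = γ₀ S`. [folklore] -/
theorem S_mul_T_zpow : ModularGroup.S * ModularGroup.T ^ (1951 : ℤ) = γ₀ * ModularGroup.S := by
  ext i j
  simp only [Matrix.SpecialLinearGroup.coe_mul, ModularGroup.coe_T_zpow, ModularGroup.S, γ₀]
  fin_cases i <;> fin_cases j <;> simp [Matrix.mul_apply, Fin.sum_univ_two]

theorem γ₀_mem : γ₀ ∈ CongruenceSubgroup.Gamma0 1951 := by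
  rw [CongruenceSubgroup.Gamma0_mem]
  simp [γ₀]
  decide

theorem T_mem : ModularGroup.T ∈ CongruenceSubgroup.Gamma0 1951 := by
  rw [CongruenceSubgroup.Gamma0_mem]
  simp [ModularGroup.T]

/-- An odd periodic function has zero integral over a period (no integrability needed). [folklore] -/
theorem intervalIntegral_eq_zero_of_odd_periodic (g : ℝ → ℂ) (P : ℝ) (hper : ∀ x, g (x + P) = g x)
    (hodd : ∀ x, g (-x) = -g x) : ∫ x in (0 : ℝ)..P, g x = 0 := by
  have hA : ∫ x in (0 : ℝ)..P, g x = ∫ x in (-P : ℝ)..0, g x := by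
    have e : (fun x => g x) = fun x => g (x - P) := by
      funext x; rw [← hper (x - P), sub_add_cancel]
    calc ∫ x in (0 : ℝ)..P, g x = ∫ x in (0 : ℝ)..P, g (x - P) := by rw [← e]
      _ = ∫ x in (0 : ℝ) - P..P - P, g x := intervalIntegral.integral_comp_sub_right _ P
      _ = ∫ x in (-P : ℝ)..0, g x := by simp
  have hB : ∫ x in (0 : ℝ)..P, g (-x) = ∫ x in (-P : ℝ)..0, g x := by
    rw [intervalIntegral.integral_comp_neg]; simp
  have hC : ∫ x in (0 : ℝ)..P, g (-x) = -∫ x in (0 : ℝ)..P, g x := by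
    rw [← intervalIntegral.integral_neg]
    exact intervalIntegral.integral_congr fun x _ => hodd x
  have h : ∫ x in (0 : ℝ)..P, g x = -∫ x in (0 : ℝ)..P, g x :=
    calc ∫ x in (0 : ℝ)..P, g x = ∫ x in (-P : ℝ)..0, g x := hA
      _ = ∫ x in (0 : ℝ)..P, g (-x) := hB.symm
      _ = -∫ x in (0 : ℝ)..P, g x := hC
  linear_combination h / 2

/-- **Stub P1 (proved).** An odd `Γ₀(1951)`-automorphic function has vanishing constant terms at both cusps of
`Γ₀(1951)`, identically in `y > 0`. [folklore] -/
theorem stub_oddConstantTerms (χ : DirichletCharacter ℂ 1951) (u : UpperHalfPlane → ℂ)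
    (haut : ∀ γ : Matrix.SpecialLinearGroup (Fin 2) ℤ, γ ∈ CongruenceSubgroup.Gamma0 1951 →
      ∀ z : UpperHalfPlane, u (γ • z) = χ ((γ 1 1 : ℤ) : ZMod 1951) * u z)
    (hodd : ∀ z : UpperHalfPlane, u (UpperHalfPlane.J • z) = - u z) :
    (∀ y : ℝ, 0 < y → ∫ x in (0 : ℝ)..1, u (UpperHalfPlane.ofComplex (x + y * Complex.I)) = 0) ∧
    (∀ y : ℝ, 0 < y →
      ∫ x in (0 : ℝ)..1951, u (ModularGroup.S • UpperHalfPlane.ofComplex (x + y * Complex.I)) = 0) := by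
  have hT1 : ((ModularGroup.T 1 1 : ℤ) : ZMod 1951) = 1 := by simp [ModularGroup.T]
  have hγ1 : ((γ₀ 1 1 : ℤ) : ZMod 1951) = 1 := by simp [γ₀]
  constructor
  · intro y hy
    apply intervalIntegral_eq_zero_of_odd_periodic (fun x : ℝ => u (ofComplex ((x : ℂ) + y * Complex.I))) 1
    · intro x
      show u (ofComplex (((x + 1 : ℝ) : ℂ) + y * Complex.I)) = u (ofComplex ((x : ℂ) + y * Complex.I))
      rw [← T_smul_ofComplex x y hy, haut _ T_mem, hT1, map_one, one_mul]
    · intro x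
      show u (ofComplex (((-x : ℝ) : ℂ) + y * Complex.I)) = -u (ofComplex ((x : ℂ) + y * Complex.I))
      rw [← J_smul_ofComplex x y hy, hodd]
  · intro y hy
    apply intervalIntegral_eq_zero_of_odd_periodic
      (fun x : ℝ => u (ModularGroup.S • ofComplex ((x : ℂ) + y * Complex.I))) 1951
    · intro x
      show u (ModularGroup.S • ofComplex (((x + 1951 : ℝ) : ℂ) + y * Complex.I)) =
        u (ModularGroup.S • ofComplex ((x : ℂ) + y * Complex.I))
      have e : ((x + 1951 : ℝ) : ℂ) = ((x + (1951 : ℤ) : ℝ) : ℂ) := by push_cast; ring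
      rw [e, ← T_zpow_smul_ofComplex 1951 x y hy, ← mul_smul, S_mul_T_zpow, mul_smul, haut _ γ₀_mem, hγ1,
        map_one, one_mul]
    · intro x
      show u (ModularGroup.S • ofComplex (((-x : ℝ) : ℂ) + y * Complex.I)) =
        -u (ModularGroup.S • ofComplex ((x : ℂ) + y * Complex.I))
      rw [← J_smul_ofComplex x y hy, S_smul_J_smul, hodd]

end Summit.Langlands.Langlands.Theorems.QuarterFingerprintDeficit
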